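/-
COR-CM (cell pub-hodgecm2, stage 2 of the Hodge ladder) — count-neutral kernel combinatorics (seat prover-pub-hodgecm2-b23-g40-0, binder
prover b23, gen 40; claim COMPLEMENT-FACES F4, HOME/INBOX.md l.9766; sequel of `Census/ComplementFacesWeil.lean`).  Two bookkeeping
definitions with bodies (`cwt`, the signed weight; `sgn`, the sign of a type) + theorems, in seat b09's intrinsic model (`CMF G c`, `rt`,
`oflipCM`, `gface`/`gfaceSet`, `pair`/`pairSet`, `translates`, `hodgeSpan`, `Block`/`blk`, `cplT`, `mixT`, and the seat's gen-38
`CyclicFaces.rt_self_ne` — consumed BY NAME, nothing restated); no certificate, no `decide`, no named fact, no geometry, no `sorry`.  `Interfaces.lean` (C1), every E term, B01 and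
`Transposition/*` are untouched.
HONEST FRAMING: `HC_CM` is NOT proved, here or anywhere in the tree; nothing here is a period or a headline.
-/
import Summits.HodgeConjecture.CorCM.Census.ComplementFacesWeil
import Summits.HodgeConjecture.CorCM.Census.CyclicFacesResidue

/-!
# Faces of a complemented Galois CM type, IV: the two closing arguments — the Weil vector from faces

By part III, modulo the pairs and the base changes of the (at most `β − 2`) canonical squares the Hodge lattice of a complemented Galois CM
type `(G, c)`, `G = A × ⟨c⟩`, is generated by the Weil vector `weil T`.  This part puts `weil T` itself into `ℤ⟨pairs⟩ ⊔ ℤ[G]·faces`: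
* §1 `n = |A| ≤ 2`: `weil T` IS a pair (`weil_mem_span_pairSet_of_card_le_two`).
* §2 **`n` ODD `≥ 3` — ONE closing face** (`exists_closing_face_of_odd`): the signed weight `cwt` (`= wt` on light types, `wt − n` on heavy
  ones) is kept along `A`, NEGATED by conjugation (`n` odd: no type has `wt = n − wt`), vanishes on every canonical square (corner weights
  `k, k − 2, k − 1, k − 1`, all light), takes the value `n` on `weil T` and the value `n` on the face `f⋆ = gface Ψ₀ i j` through two
  agreement places of a type `Ψ₀` of weight `(n − 1)/2` (signed corner weights `K, 1 − K, −K, −K`); since `f⋆ ≡ k·weil` (part III),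
  `n = k·n`, `k = 1`, and `weil T ∈ ℤ⟨pairs⟩ ⊔ ℤ[G]·(squares ∪ {f⋆})`.
* §3 **`n` EVEN `≥ 4` — NO extra face** (`weil_mem_rel_of_even`): the sign `sgn` (`+1 / −1 / 0` for `2·wt <, >, = n`) is kept along `A`,
  negated by conjugation, vanishes on the squares of class `< n/2`, is `−1` on a square of class `n/2` and `2` on `weil T`.  Cauchy gives an
  involution `b ∈ A`, seat b09's mixed type `Ψ₀ = mixT` has `Ψ₀·b⁻¹ = Ψ̄₀` (`rt_mixT`), and so does the normalised representative `ρ` of its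
  block for the conjugate involution `t = Q⁻¹bQ ∈ A` (`A` is normal of index two); `ρ` has weight `n/2`, and for the canonical square `s`
  of that block `z = s + s·t⁻¹ − ([ρ] + [ρ̄])` is a Hodge vector supported in class `≤ n/2 − 1`, so `z ≡ k·weil` modulo pairs and squares of
  class `≤ n/2 − 1` (part III, class-bounded); evaluating `sgn`: `−1 − 1 − 0 = 2k`, `k = −1`, and `weil T ∈ ℤ⟨pairs⟩ ⊔ ℤ[G]·squares`.
Part V (`Census/ComplementFacesGenerate.lean`) assembles the main theorem.  No commutativity of `A` is used.  All [folklore] bookkeeping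
over [Pohlmann1968, Thm 1] in the reading of [Milne1999, Prop. 2.1].

## References
* [Pohlmann1968] H. Pohlmann, Algebraic cycles on abelian varieties of complex multiplication type, Ann. of Math. 88 (1968), Thm 1.
* [Milne1999] J. S. Milne, Lefschetz motives and the Tate conjecture, Compositio Math. 117 (1999), Prop. 2.1, p. 54.
* [Weil1977HodgeRing] A. Weil, Abelian varieties and the Hodge ring, Œuvres Scientifiques III, [1977c], 421–429.
-/

namespace Summit.HodgeConjecture.CorCM.Census.ComplementFaces

open Finset
open scoped symmDiff
open Summit.HodgeConjecture.CorCM.Prior.AllgGroup.RfwfAllgGroup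
open Summit.HodgeConjecture.CorCM.Census.BlockParity
open Summit.HodgeConjecture.CorCM.Census.Coinvariant

noncomputable section

variable {G : Type*} [Group G] [Fintype G] [DecidableEq G] (c : G)

/-! ## §1 `|T| ≤ 2`: the Weil vector is a pair -/

/-- `|T| = 1`: the conjugate of `T` is its single flip, and `weil T = [T] + [T̄]` is a pair. [folklore] -/
theorem weil_eq_pair_of_card_eq_one (hc2 : c * c = 1) (hcen : ∀ x : G, x * c = c * x) {T : CMF G c} (h1 : T.1.card = 1) :
    weil c hc2 T = pair c T := by
  obtain ⟨x₀, hx₀⟩ := card_eq_one.mp h1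
  have hw : wt c T (rt c c T) = 1 := by rw [wt_rt_self c hcen, wt_self, h1]
  obtain ⟨d, hd, hd'⟩ := exists_eq_oflipCM_of_wt_eq_one c hc2 hw
  have hdx : d = x₀ := by rw [hx₀] at hd; exact mem_singleton.mp hd
  rw [weil, pair, hd', hdx, hx₀, sum_singleton, card_singleton]
  simp only [Nat.cast_one]
  rw [show ((1 : ℤ) - 2) = -1 by norm_num, neg_smul, one_smul, sub_neg_eq_add, add_comm]

/-- `|T| = 2`, `T = {x, y}`: the conjugate of `T^{(x)}` is `T^{(y)}`, and `weil T = [T^{(x)}] + [T^{(y)}]` is a pair. [folklore] -/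
theorem weil_mem_span_pairSet_of_card_eq_two (hc2 : c * c = 1) (hcen : ∀ x : G, x * c = c * x) {T : CMF G c}
    (h2 : T.1.card = 2) : weil c hc2 T ∈ Submodule.span ℤ (pairSet c) := by
  obtain ⟨x, y, hxy, hT⟩ := card_eq_two.mp h2
  have hx : x ∈ T.1 := by rw [hT]; exact mem_insert_self _ _
  have hy : y ∈ T.1 := by rw [hT]; exact mem_insert_of_mem (mem_singleton_self _)
  -- the conjugate of `T^{(x)}` has weight `1`, so it is a single flip `T^{(d)}`, and `d ≠ x`
  have hw : wt c T (rt c c (oflipCM c hc2 x T)) = 1 := by rw [wt_rt_self c hcen, wt_oflipCM_self c hc2 hx, h2]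
  obtain ⟨d, hd, hd'⟩ := exists_eq_oflipCM_of_wt_eq_one c hc2 hw
  have hdx : d ≠ x := by
    rintro rfl
    exact CyclicFaces.rt_self_ne c _ hd'
  have hdy : d = y := by
    rw [hT, mem_insert, mem_singleton] at hd
    exact hd.resolve_left hdx
  have hsum : (∑ d ∈ T.1, Finsupp.single (oflipCM c hc2 d T) (1 : ℤ)) =
      Finsupp.single (oflipCM c hc2 x T) 1 + Finsupp.single (oflipCM c hc2 y T) 1 := by
    rw [hT, sum_pair hxy]
  have hweil : weil c hc2 T = pair c (oflipCM c hc2 x T) := by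
    rw [weil, pair, hd', hdy, hsum, h2]
    simp
  rw [hweil]
  exact Submodule.subset_span (pair_mem_pairSet c _)

/-- **`|T| ≤ 2`: the Weil vector lies in `ℤ⟨pairs⟩`.** [folklore] -/
theorem weil_mem_span_pairSet_of_card_le_two (hc2 : c * c = 1) (hcen : ∀ x : G, x * c = c * x) {T : CMF G c}
    (hT : T.1.Nonempty) (h : T.1.card ≤ 2) : weil c hc2 T ∈ Submodule.span ℤ (pairSet c) := by
  have h1 : 1 ≤ T.1.card := card_pos.mpr hT
  rcases Nat.le_succ_iff.mp h with h' | h'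
  · rw [weil_eq_pair_of_card_eq_one c hc2 hcen (by omega)]
    exact Submodule.subset_span (pair_mem_pairSet c _)
  · exact weil_mem_span_pairSet_of_card_eq_two c hc2 hcen h'

/-! ## §2 `n` odd: the signed weight and the closing face -/

/-- **The signed weight**: `wt` on light types, `wt − n` on heavy types. [folklore] -/
def cwt (T Ψ : CMF G c) : ℤ := if wt c T Ψ ≤ T.1.card - wt c T Ψ then (wt c T Ψ : ℤ) else (wt c T Ψ : ℤ) - T.1.card

/-- For `|T|` odd, conjugation negates the signed weight. [folklore] -/
theorem cwt_rt_self (hcen : ∀ x : G, x * c = c * x) {T : CMF G c} (hodd : Odd T.1.card) (Ψ : CMF G c) :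
    cwt c T (rt c c Ψ) = -cwt c T Ψ := by
  obtain ⟨r, hr⟩ := hodd
  have hle := wt_le c T Ψ
  unfold cwt
  rw [wt_rt_self c hcen, Nat.sub_sub_self hle]
  split_ifs <;> omega

/-- A type of co-weight `≥ 2` agrees with `T` at two distinct places. [folklore] -/
theorem exists_two_mems {T Ψ : CMF G c} (h : wt c T Ψ + 2 ≤ T.1.card) :
    ∃ i j : G, i ∈ T.1 ∧ i ∈ Ψ.1 ∧ j ∈ T.1 ∧ j ∈ Ψ.1 ∧ i ≠ j := by
  have hlt : 1 < (T.1 \ (T.1 \ Ψ.1)).card := by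
    rw [card_sdiff_of_subset sdiff_subset]; unfold wt at h; omega
  obtain ⟨i, hi, j, hj, hne⟩ := one_lt_card.mp hlt
  rw [mem_sdiff] at hi hj
  refine ⟨i, j, hi.1, ?_, hj.1, ?_, hne⟩
  · by_contra h'; exact hi.2 (mem_sdiff.mpr ⟨hi.1, h'⟩)
  · by_contra h'; exact hj.2 (mem_sdiff.mpr ⟨hj.1, h'⟩)

section Complement

variable {A : Subgroup G} (hA : ∀ x : G, x ∈ A ↔ c * x ∉ A)

/-- Base change along `A` keeps the signed weight. [folklore] -/
theorem cwt_rt_of_mem {a : G} (ha : a ∈ A) (Ψ : CMF G c) : cwt c (cplT c A hA) (rt c a Ψ) = cwt c (cplT c A hA) Ψ := by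
  unfold cwt; rw [wt_rt_of_mem c hA ha]

/-- **The signed weight vanishes on every canonical square** (corner weights `k, k − 2, k − 1, k − 1`, all light). [folklore] -/
theorem lc_cwt_sq (hc2 : c * c = 1) (hcen : ∀ x : G, x * c = c * x) {B : Block c} (hB : 2 ≤ bcls c hA B) :
    Finsupp.linearCombination ℤ (cwt c (cplT c A hA)) (sq c hA hc2 hcen B) = 0 := by
  obtain ⟨hw₁, hw₂, hw₃⟩ := wt_corners_sq c hA hc2 hcen hB
  have hρ := wt_nrep c hA hcen B
  have h2k := two_mul_bcls_le c hA B
  rw [sq, lc_gface]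
  unfold cwt
  rw [if_pos (by omega), if_pos (by omega), if_pos (by omega), if_pos (by omega)]
  omega

/-- **The signed weight of the Weil vector is `n`** (`n ≥ 2`). [folklore] -/
theorem lc_cwt_weil (hc2 : c * c = 1) {T : CMF G c} (h2 : 2 ≤ T.1.card) :
    Finsupp.linearCombination ℤ (cwt c T) (weil c hc2 T) = T.1.card := by
  rw [lc_weil, Finset.sum_congr rfl fun d hd => show cwt c T (oflipCM c hc2 d T) = 1 by
      unfold cwt; rw [wt_oflipCM_self c hc2 hd, if_pos (by omega)]; rfl,
    sum_const, nsmul_eq_mul, mul_one]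
  unfold cwt
  rw [wt_self, if_pos (Nat.zero_le _)]
  push_cast
  ring

/-- **`n` ODD `≥ 3`: ONE CLOSING FACE.**  There is a face relation `f⋆` with `weil T ∈ ℤ⟨pairs⟩ ⊔ ℤ⟨base changes of the canonical squares
and of f⋆⟩`. [folklore] -/
theorem exists_closing_face_of_odd (hc2 : c * c = 1) (hcen : ∀ x : G, x * c = c * x)
    (hodd : Odd (cplT c A hA).1.card) (h3 : 3 ≤ (cplT c A hA).1.card) :
    ∃ f ∈ gfaceSet G c hc2, weil c hc2 (cplT c A hA) ∈ Submodule.span ℤ (pairSet c) ⊔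
      Submodule.span ℤ (translates c (insert f (squaresLE c hA hc2 hcen ((cplT c A hA).1.card / 2)))) := by
  obtain ⟨r, hr⟩ := hodd
  set n := (cplT c A hA).1.card with hn
  -- a type of weight `K = (n − 1)/2 = r` and two agreement places
  obtain ⟨Ψ₀, hΨ₀⟩ := exists_wt_eq c hc2 (cplT c A hA) r (by omega)
  obtain ⟨i, j, hi, hiΨ, hj, hjΨ, hij⟩ := exists_two_mems c (T := cplT c A hA) (Ψ := Ψ₀) (by omega)
  set f := gface c hc2 Ψ₀ i j with hf
  have hfG : f ∈ gfaceSet G c hc2 := ⟨Ψ₀, i, j, notMem_orb_of_mem c hi hj hij.symm, rfl⟩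
  refine ⟨f, hfG, ?_⟩
  -- `f ≡ k·weil` modulo pairs and squares
  have hfH : f ∈ hodgeSpan c hc2 := gfaceSet_subset_hodgeSpan c hc2 hfG
  obtain ⟨k, hk⟩ := exists_sub_smul_weil_mem c hA hc2 hcen (n / 2) hfH fun Ψ _ => lvl_le_card c _ Ψ
  -- the signed weight kills the relations and reads `n` on both `f` and `weil`
  have hfa : ∀ a ∈ A, ∀ Ψ, cwt c (cplT c A hA) (rt c a Ψ) = cwt c (cplT c A hA) Ψ := fun a ha Ψ => cwt_rt_of_mem c hA ha Ψ
  have hfc : ∀ Ψ, cwt c (cplT c A hA) (rt c c Ψ) = -cwt c (cplT c A hA) Ψ := cwt_rt_self c hcen ⟨r, hr⟩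
  have hS : ∀ s ∈ squaresLE c hA hc2 hcen (n / 2), Finsupp.linearCombination ℤ (cwt c (cplT c A hA)) s = 0 := by
    intro s hs
    obtain ⟨B, hB, rfl⟩ := mem_image.mp hs
    exact lc_cwt_sq c hA hc2 hcen (mem_filter.mp hB).2.1
  have h0 := lc_eq_zero_of_mem c hA hc2 hfa hfc _ hS hk
  -- corner weights of `f`: `r`, `r + 2`, `r + 1`, `r + 1`
  have hwi : wt c (cplT c A hA) (oflipCM c hc2 i Ψ₀) = r + 1 := by rw [wt_oflipCM_of_mem c hc2 hi hiΨ, hΨ₀]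
  have hwj : wt c (cplT c A hA) (oflipCM c hc2 j Ψ₀) = r + 1 := by rw [wt_oflipCM_of_mem c hc2 hj hjΨ, hΨ₀]
  have hiΨ' : i ∈ (oflipCM c hc2 j Ψ₀).1 := by
    rw [mem_oflipCM_iff_of_notMem_orb c hc2 (notMem_orb_of_mem c hj hi hij)]; exact hiΨ
  have hwij : wt c (cplT c A hA) (oflipCM c hc2 i (oflipCM c hc2 j Ψ₀)) = r + 2 := by
    rw [wt_oflipCM_of_mem c hc2 hi hiΨ', hwj]
  have hlcf : Finsupp.linearCombination ℤ (cwt c (cplT c A hA)) f = n := by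
    rw [hf, lc_gface]
    unfold cwt
    rw [hΨ₀, hwi, hwj, hwij, if_pos (by omega), if_neg (by omega), if_neg (by omega)]
    push_cast
    omega
  rw [map_sub, map_smul, hlcf, lc_cwt_weil c hc2 (by omega), smul_eq_mul, ← hn] at h0
  have hk1 : k = 1 := by
    have hn0 : (n : ℤ) ≠ 0 := by exact_mod_cast (show n ≠ 0 by omega)
    have h' : (1 - k) * (n : ℤ) = 0 := by linear_combination h0
    rcases mul_eq_zero.mp h' with h | h
    · omega
    · exact absurd h hn0
  rw [hk1, one_smul] at hk
  -- `weil = f − (f − weil)`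
  have e : weil c hc2 (cplT c A hA) = f - (f - weil c hc2 (cplT c A hA)) := by abel
  rw [e]
  refine Submodule.sub_mem _ (Submodule.mem_sup_right (Submodule.subset_span (mem_translates_of_mem c (mem_insert_self _ _)))) ?_
  exact rel_mono c (subset_insert _ _) hk

/-! ## §3 `n` even: the sign functional and the anti-periodic closing -/

/-- **The sign** of a type: `+1` if `2·wt < n`, `−1` if `2·wt > n`, `0` if `2·wt = n`. [folklore] -/
def sgn (T Ψ : CMF G c) : ℤ := if 2 * wt c T Ψ < T.1.card then 1 else if T.1.card < 2 * wt c T Ψ then -1 else 0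

/-- Conjugation negates the sign (any `n`, central `c`). [folklore] -/
theorem sgn_rt_self (hcen : ∀ x : G, x * c = c * x) (T Ψ : CMF G c) : sgn c T (rt c c Ψ) = -sgn c T Ψ := by
  have hle := wt_le c T Ψ
  unfold sgn
  rw [wt_rt_self c hcen]
  split_ifs <;> omega

/-- Base change along `A` keeps the sign. [folklore] -/
theorem sgn_rt_of_mem {a : G} (ha : a ∈ A) (Ψ : CMF G c) : sgn c (cplT c A hA) (rt c a Ψ) = sgn c (cplT c A hA) Ψ := by
  unfold sgn; rw [wt_rt_of_mem c hA ha]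

/-- **The sign vanishes on a canonical square of class `< n/2`** (signs `+, +, +, +` with coefficients `1, 1, −1, −1`). [folklore] -/
theorem lc_sgn_sq_of_lt (hc2 : c * c = 1) (hcen : ∀ x : G, x * c = c * x) {B : Block c} (hB : 2 ≤ bcls c hA B)
    (hlt : 2 * bcls c hA B < (cplT c A hA).1.card) :
    Finsupp.linearCombination ℤ (sgn c (cplT c A hA)) (sq c hA hc2 hcen B) = 0 := by
  obtain ⟨hw₁, hw₂, hw₃⟩ := wt_corners_sq c hA hc2 hcen hB
  have hρ := wt_nrep c hA hcen B
  rw [sq, lc_gface]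
  unfold sgn
  rw [if_pos (by omega), if_pos (by omega), if_pos (by omega), if_pos (by omega)]
  ring

/-- **The sign of a canonical square of class `= n/2` is `−1`** (signs `0, +, +, +`). [folklore] -/
theorem lc_sgn_sq_of_eq (hc2 : c * c = 1) (hcen : ∀ x : G, x * c = c * x) {B : Block c} (hB : 2 ≤ bcls c hA B)
    (heq : 2 * bcls c hA B = (cplT c A hA).1.card) :
    Finsupp.linearCombination ℤ (sgn c (cplT c A hA)) (sq c hA hc2 hcen B) = -1 := by
  obtain ⟨hw₁, hw₂, hw₃⟩ := wt_corners_sq c hA hc2 hcen hB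
  have hρ := wt_nrep c hA hcen B
  rw [sq, lc_gface]
  unfold sgn
  rw [if_neg (by omega), if_neg (by omega), if_pos (by omega), if_pos (by omega), if_pos (by omega)]
  ring

/-- **The sign of the Weil vector is `2`** (`n ≥ 3`). [folklore] -/
theorem lc_sgn_weil (hc2 : c * c = 1) {T : CMF G c} (h3 : 3 ≤ T.1.card) :
    Finsupp.linearCombination ℤ (sgn c T) (weil c hc2 T) = 2 := by
  rw [lc_weil, Finset.sum_congr rfl fun d hd => show sgn c T (oflipCM c hc2 d T) = 1 by
      unfold sgn; rw [wt_oflipCM_self c hc2 hd, if_pos (by omega)],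
    sum_const, nsmul_eq_mul, mul_one]
  unfold sgn
  rw [wt_self, mul_zero, if_pos (by omega)]
  ring

/-- **An anti-periodic normalised representative** (`n` even): for an involution of `A` (Cauchy) seat b09's mixed type `Ψ₀` has
`Ψ₀·b⁻¹ = Ψ̄₀`; the normalised representative `ρ` of its block satisfies `ρ·t⁻¹ = ρ̄` for a conjugate `t ∈ A` of `b` (`A ⊴ G`), and has
weight `n/2`. [folklore] -/
theorem exists_antiperiodic_nrep (hc2 : c * c = 1) (hcen : ∀ x : G, x * c = c * x) (heven : Even (Fintype.card G / 2)) :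
    ∃ (B : Block c) (t : G), t ∈ A ∧ rt c t (nrep c hA hcen B) = rt c c (nrep c hA hcen B) ∧
      2 * wt c (cplT c A hA) (nrep c hA hcen B) = (cplT c A hA).1.card := by
  obtain ⟨b, hb, hb2, hb1⟩ := exists_mem_cpl_mul_self_eq_one c hc2 hA heven
  obtain ⟨S₀, hS, hS₀⟩ := exists_halfSet c hA hb hb2 hb1
  set Ψ₀ := mixT c hc2 hA S₀ hS with hΨ₀
  have hanti : rt c b Ψ₀ = rt c c Ψ₀ := rt_mixT c hc2 hcen hA hb hS hS₀
  obtain ⟨Q, hQ⟩ := exists_rt_nrep_eq c hA hcen Ψ₀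
  haveI : A.Normal := Subgroup.normal_of_index_eq_two (index_eq_two_of_cpl c hcen hA)
  set t := Q⁻¹ * b * Q⁻¹⁻¹ with ht
  have htA : t ∈ A := Subgroup.Normal.conj_mem inferInstance b hb Q⁻¹
  have hρ : nrep c hA hcen (blk c Ψ₀) = rt c Q⁻¹ Ψ₀ := by
    conv_rhs => rw [← hQ, rt_inv_rt]
  have hanti' : rt c t (nrep c hA hcen (blk c Ψ₀)) = rt c c (nrep c hA hcen (blk c Ψ₀)) := by
    rw [hρ, ht, inv_inv, ← rt_mul, mul_inv_cancel_right, rt_mul, hanti, ← rt_mul, hcen Q⁻¹, rt_mul]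
  refine ⟨blk c Ψ₀, t, htA, hanti', ?_⟩
  have h1 : wt c (cplT c A hA) (rt c t (nrep c hA hcen (blk c Ψ₀))) = wt c (cplT c A hA) (nrep c hA hcen (blk c Ψ₀)) :=
    wt_rt_of_mem c hA htA _
  rw [hanti', wt_rt_self c hcen] at h1
  have := wt_le c (cplT c A hA) (nrep c hA hcen (blk c Ψ₀))
  omega

/-- **`n` EVEN `≥ 4`: NO EXTRA FACE.**  `weil T ∈ ℤ⟨pairs⟩ ⊔ ℤ⟨base changes of the canonical squares⟩`. [folklore] -/
theorem weil_mem_rel_of_even (hc2 : c * c = 1) (hcen : ∀ x : G, x * c = c * x) (heven : Even (Fintype.card G / 2))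
    (h4 : 4 ≤ (cplT c A hA).1.card) :
    weil c hc2 (cplT c A hA) ∈ Submodule.span ℤ (pairSet c) ⊔
      Submodule.span ℤ (translates c (squaresLE c hA hc2 hcen ((cplT c A hA).1.card / 2))) := by
  set n := (cplT c A hA).1.card with hn
  obtain ⟨B, t, htA, hanti, hwt⟩ := exists_antiperiodic_nrep c hA hc2 hcen heven
  set ρ := nrep c hA hcen B with hρ
  have hB : bcls c hA B = wt c (cplT c A hA) ρ := (wt_nrep c hA hcen B).symm
  have hB2 : 2 ≤ bcls c hA B := by omega
  have hBm : bcls c hA B ≤ n / 2 := by omega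
  -- the square `s` of `B`, its base change `s' = s·t⁻¹`, the pair of `ρ`
  set s := sq c hA hc2 hcen B with hs
  set s' := Finsupp.mapDomain (rt c t) s with hs'
  set L := Submodule.span ℤ (pairSet c) ⊔ Submodule.span ℤ (translates c (squaresLE c hA hc2 hcen (n / 2))) with hL
  have hsL : s ∈ L := Submodule.mem_sup_right (Submodule.subset_span (mem_translates_of_mem c (sq_mem_squaresLE c hA hc2 hcen hB2 hBm)))
  have hs'L : s' ∈ L := Submodule.mem_sup_right (Submodule.subset_span ⟨t, s, sq_mem_squaresLE c hA hc2 hcen hB2 hBm, rfl⟩)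
  have hpL : pair c ρ ∈ L := Submodule.mem_sup_left (Submodule.subset_span (pair_mem_pairSet c ρ))
  set z := s + s' - pair c ρ with hz
  have hzL : z ∈ L := Submodule.sub_mem _ (Submodule.add_mem _ hsL hs'L) hpL
  have hzH : z ∈ hodgeSpan c hc2 := rel_le_hodgeSpan c hA hc2 hcen _ hzL
  -- the corners of `s` other than `ρ`, and their `t`-base changes, have class `≤ n/2 − 1`
  obtain ⟨hw₁, hw₂, hw₃⟩ := wt_corners_sq c hA hc2 hcen hB2
  set d := (sqPlaces c hA hcen B).1 with hd
  set d' := (sqPlaces c hA hcen B).2 with hd'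
  set X₁ := oflipCM c hc2 d ρ with hX₁
  set X₂ := oflipCM c hc2 d' ρ with hX₂
  set X₃ := oflipCM c hc2 d (oflipCM c hc2 d' ρ) with hX₃
  have hz' : z = (Finsupp.single X₃ 1 - Finsupp.single X₁ 1 - Finsupp.single X₂ 1) +
      (Finsupp.single (rt c t X₃) 1 - Finsupp.single (rt c t X₁) 1 - Finsupp.single (rt c t X₂) 1) := by
    rw [hz, hs', hs, sq, gface, pair]
    simp only [Finsupp.mapDomain_add, Finsupp.mapDomain_sub, Finsupp.mapDomain_single]
    rw [← hρ, ← hd, ← hd', ← hX₁, ← hX₂, ← hX₃, hanti]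
    abel
  have hlow : ∀ X : CMF G c, cls c (cplT c A hA) X + 1 ≤ wt c (cplT c A hA) ρ →
      lvl c (cplT c A hA) X ≤ 2 * (n / 2 - 1) + 1 := by
    intro X hX
    have := lvl_le c (cplT c A hA) X
    omega
  have hc₁ : cls c (cplT c A hA) X₁ + 1 ≤ wt c (cplT c A hA) ρ := by
    have := cls_le_wt c (cplT c A hA) X₁; omega
  have hc₂ : cls c (cplT c A hA) X₂ + 1 ≤ wt c (cplT c A hA) ρ := by
    have := cls_le_wt c (cplT c A hA) X₂; omega
  have hc₃ : cls c (cplT c A hA) X₃ + 1 ≤ wt c (cplT c A hA) ρ := by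
    have := cls_le_wt c (cplT c A hA) X₃; omega
  have hlvl : ∀ Ψ ∈ z.support, lvl c (cplT c A hA) Ψ ≤ 2 * (n / 2 - 1) + 1 := by
    intro Ψ hΨ
    by_contra hbad
    have ne : ∀ X : CMF G c, cls c (cplT c A hA) X + 1 ≤ wt c (cplT c A hA) ρ → X ≠ Ψ ∧ rt c t X ≠ Ψ := by
      intro X hX
      constructor
      · rintro rfl; exact hbad (hlow X hX)
      · rintro rfl; exact hbad (hlow _ (by rw [cls_rt c hA hc2 hcen]; exact hX))
    rw [Finsupp.mem_support_iff, hz'] at hΨ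
    simp only [Finsupp.add_apply, Finsupp.sub_apply, Finsupp.single_apply, if_neg (ne X₁ hc₁).1, if_neg (ne X₂ hc₂).1,
      if_neg (ne X₃ hc₃).1, if_neg (ne X₁ hc₁).2, if_neg (ne X₂ hc₂).2, if_neg (ne X₃ hc₃).2, sub_zero, add_zero] at hΨ
    exact hΨ rfl
  -- `z ≡ k·weil` modulo pairs and squares of class `≤ n/2 − 1`
  obtain ⟨k, hk⟩ := exists_sub_smul_weil_mem c hA hc2 hcen (n / 2 - 1) hzH hlvl
  -- evaluate the sign functional
  have hfa : ∀ a ∈ A, ∀ Ψ, sgn c (cplT c A hA) (rt c a Ψ) = sgn c (cplT c A hA) Ψ := fun a ha Ψ => sgn_rt_of_mem c hA ha Ψ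
  have hfc : ∀ Ψ, sgn c (cplT c A hA) (rt c c Ψ) = -sgn c (cplT c A hA) Ψ := sgn_rt_self c hcen (cplT c A hA)
  have hS : ∀ x ∈ squaresLE c hA hc2 hcen (n / 2 - 1), Finsupp.linearCombination ℤ (sgn c (cplT c A hA)) x = 0 := by
    intro x hx
    obtain ⟨B', hB', rfl⟩ := mem_image.mp hx
    obtain ⟨-, hB'2, hB'm⟩ := mem_filter.mp hB'
    exact lc_sgn_sq_of_lt c hA hc2 hcen hB'2 (by omega)
  have h0 := lc_eq_zero_of_mem c hA hc2 hfa hfc _ hS hk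
  have hlcs : Finsupp.linearCombination ℤ (sgn c (cplT c A hA)) s = -1 := lc_sgn_sq_of_eq c hA hc2 hcen hB2 (by omega)
  have hlcs' : Finsupp.linearCombination ℤ (sgn c (cplT c A hA)) s' = -1 := by
    rw [hs', lc_mapDomain_rt_of_mem c hfa htA, hlcs]
  have hlcp : Finsupp.linearCombination ℤ (sgn c (cplT c A hA)) (pair c ρ) = 0 := lc_pair c hfc ρ
  rw [map_sub, map_smul, hz, map_sub, map_add, hlcs, hlcs', hlcp, lc_sgn_weil c hc2 (by omega), smul_eq_mul] at h0
  have hk1 : k = -1 := by omega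
  rw [hk1, neg_smul, one_smul, sub_neg_eq_add] at hk
  -- `weil = (z + weil) − z`
  have e : weil c hc2 (cplT c A hA) = (z + weil c hc2 (cplT c A hA)) - z := by abel
  rw [e]
  exact Submodule.sub_mem _ (rel_mono c (squaresLE_mono c hA hc2 hcen (by omega)) hk) hzL

end Complement

end

end Summit.HodgeConjecture.CorCM.Census.ComplementFaces
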